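import Literature.AlgebraicGeometry.Morphisms.DevissageHeartOZ
import HarnessLib

/-!
# Dévissage, integral case: the ideals `(𝒥₂/𝒥) ⊆ 𝒪_Z` of smaller closed subschemes are in `𝒦`

For the integral closed subscheme `ι : Z = V(𝒥) ↪ X` of the proper `A`-scheme `X` and an ideal
sheaf `𝒥₂ > 𝒥` (closed subscheme `Z₂ ⊊ Z`, Mathlib `IdealSheafData.inclusion`), the kernel
`H_{𝒥₂} := ker(ι_*𝒪_Z → ι_*𝒪_{Z₂}) ⊆ ι_*𝒪_Z` — the ideal `𝒥₂𝒪_Z` of `Z₂` in `Z`, a coherent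
`𝒪_X`-module annihilated by `𝒥` — lies in the dévissage class `𝒦`: its cokernel in `ι_*𝒪_Z` is
coherent and annihilated by `𝒥₂`, so lies in `𝒦` by the induction hypothesis, and `ι_*𝒪_Z ∈ 𝒦`
(`Morphisms/DevissageHeartOZ`); conclude by `InK.of_shortExact₁`. These are the rank-one building
blocks `H` of step (iii) of Görtz–Wedhorn I, Lemma 12.63 ("a coherent `𝒪_Z`-module `𝓗` such that
`𝓗_η ≠ 0` and such that `i_*𝓗` is in `𝒦`"), with the flexibility in `𝒥₂` needed to realise local
sections as morphisms `H_{𝒥₂} → M`.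

* `idealOZ J h` (`h : J ≤ J₂`) — the module `H_{𝒥₂}`; `idealOZHom` — the map `ι_*𝒪_Z → ι_*𝒪_{Z₂}`;
* `coh_pushforward_unit_subscheme`, `coh_idealOZ`, `isKilledBy_cokernel_idealOZ`;
* `inK_idealOZ` — **`H_{𝒥₂} ∈ 𝒦`**.

Everything is proved; no named facts.

## References

* U. Görtz, T. Wedhorn, *Algebraic Geometry I: Schemes*, 2nd ed. (2020): Lemma 12.63 (iii), p. 437.
  [GortzWedhorn2020]
-/

noncomputable section

open CategoryTheory CategoryTheory.Limits AlgebraicGeometry TopologicalSpace Opposite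
open Literature.AlgebraicGeometry.Modules

universe u v

namespace Literature.AlgebraicGeometry.Morphisms

variable {X : Scheme.{u}} (J : X.IdealSheafData) {J₂ : X.IdealSheafData} (h : J ≤ J₂)

/-- The restriction map `ι_*𝒪_Z → ι_*𝒪_{Z₂}` for `Z₂ = V(𝒥₂) ⊆ Z = V(𝒥)`. [folklore] -/
abbrev idealOZHom :
    (Scheme.Modules.pushforward J.subschemeι).obj (SheafOfModules.unit J.subscheme.ringCatSheaf) ⟶
      (Scheme.Modules.pushforward (Scheme.IdealSheafData.inclusion h ≫ J.subschemeι)).obj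
        (SheafOfModules.unit J₂.subscheme.ringCatSheaf) :=
  pushforwardUnitHom (Scheme.IdealSheafData.inclusion h) J.subschemeι

/-- **The ideal `𝒥₂𝒪_Z ⊆ ι_*𝒪_Z` of `Z₂` in `Z`**, as an `𝒪_X`-module: the kernel of
`ι_*𝒪_Z → ι_*𝒪_{Z₂}`. [folklore] -/
abbrev idealOZ : X.Modules := kernel (idealOZHom J h)

variable {J h}

/-- `ι_*𝒪_Z` is coherent (`X` locally Noetherian). [folklore] -/
theorem coh_pushforward_unit_subscheme [IsLocallyNoetherian X] (I : X.IdealSheafData) :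
    Coh ((Scheme.Modules.pushforward I.subschemeι).obj (SheafOfModules.unit I.subscheme.ringCatSheaf)) :=
  ⟨IsAffineLocalizing.pushforward_unit _, IsAffineFiniteType.pushforward_unit _⟩

/-- `ι_*𝒪_{Z₂}` (pushed forward through `Z`) is coherent. [folklore] -/
theorem coh_pushforward_unit_inclusion [IsLocallyNoetherian X] :
    Coh ((Scheme.Modules.pushforward (Scheme.IdealSheafData.inclusion h ≫ J.subschemeι)).obj
      (SheafOfModules.unit J₂.subscheme.ringCatSheaf)) := by
  rw [Scheme.IdealSheafData.inclusion_subschemeι]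
  exact coh_pushforward_unit_subscheme J₂

/-- `H_{𝒥₂}` is coherent. [folklore] -/
theorem coh_idealOZ [IsLocallyNoetherian X] : Coh (idealOZ J h) :=
  ⟨IsAffineLocalizing.kernel _ (coh_pushforward_unit_subscheme J).loc (coh_pushforward_unit_inclusion).loc,
    IsAffineFiniteType.kernel _ (coh_pushforward_unit_subscheme J).ft⟩

/-- `𝒥 H_{𝒥₂} = 0`. [folklore] -/
theorem isKilledBy_idealOZ : IsKilledBy J (idealOZ J h) := by
  intro W r hr k
  apply kernel_ι_app_injective
  rw [Scheme.Modules.Hom.app_smul, map_zero]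
  have := isKilledBy_pushforward_unit_subscheme J (𝟙 J.subscheme) W r hr
  rw [Category.id_comp] at this
  exact this _

/-- The short exact sequence `0 → H_{𝒥₂} → ι_*𝒪_Z → Q → 0`. [folklore] -/
theorem shortExact_idealOZ :
    (ShortComplex.mk (kernel.ι (idealOZHom J h)) (cokernel.π (kernel.ι (idealOZHom J h)))
      (cokernel.condition _)).ShortExact :=
  ShortComplex.ShortExact.mk' (ShortComplex.exact_cokernel _) inferInstance inferInstance

/-- **The quotient `ι_*𝒪_Z / H_{𝒥₂}` is annihilated by `𝒥₂`.** [folklore] -/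
theorem isKilledBy_cokernel_idealOZ [IsLocallyNoetherian X] :
    IsKilledBy J₂ (cokernel (kernel.ι (idealOZHom J h))) := by
  intro W r hr q
  obtain ⟨p, rfl⟩ := app_surjective_of_shortExact (shortExact_idealOZ (J := J) (h := h))
    (coh_idealOZ (J := J) (h := h)).loc W.2 q
  rw [← Scheme.Modules.Hom.app_smul]
  -- `r • p` lies in the kernel of `ι_*𝒪_Z → ι_*𝒪_{Z₂}`
  have hrp : (idealOZHom J h).app W (r • p) = 0 := by
    rw [Scheme.Modules.Hom.app_smul]
    have h0 := isKilledBy_pushforward_unit_subscheme J₂ (𝟙 J₂.subscheme) W r hr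
    rw [Category.id_comp, ← Scheme.IdealSheafData.inclusion_subschemeι h] at h0
    exact h0 _
  obtain ⟨k, hk⟩ := exists_kernel_ι_app_eq (idealOZHom J h) W (r • p) hrp
  rw [← hk]
  exact app_app_eq_zero (ShortComplex.mk (kernel.ι (idealOZHom J h))
    (cokernel.π (kernel.ι (idealOZHom J h))) (cokernel.condition _)) W k

variable {A : Type u} [CommRing A] [IsNoetherianRing A] [IsLocallyNoetherian X] [CompactSpace X]
  {f : X ⟶ Spec (.of A)} [IsProper f] {κ : Type v} {U : κ → X.Opens}

/-- **`H_{𝒥₂} ∈ 𝒦` for `𝒥₂ > 𝒥`**, `𝒥` a proper radical ideal sheaf with irreducible support, granted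
the dévissage claim above `𝒥`. [cite: GortzWedhorn2020, Lemma 12.63 (iii) (p. 437)] -/
theorem inK_idealOZ (hU : ∀ i, IsAffineOpen (U i)) (hUcov : ⨆ i, U i = ⊤)
    (hJtop : J ≠ ⊤) (hJrad : J.radical = J) (hJirr : IsPreirreducible ((J.support : Closeds X) : Set X))
    (ih : ∀ J' > J, ∀ M : X.Modules, Coh M → IsKilledBy J' M → InK f U M) (hlt : J < J₂) :
    InK f U (idealOZ J hlt.le) := by
  have hH := inK_pushforward_unit_subscheme hU hUcov J hJtop hJrad hJirr ih
  have hQcoh : Coh (cokernel (kernel.ι (idealOZHom J hlt.le))) :=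
    ⟨IsAffineLocalizing.of_shortExact₃ shortExact_idealOZ coh_idealOZ.loc (coh_pushforward_unit_subscheme J).loc,
      IsAffineFiniteType.of_shortExact₃ shortExact_idealOZ coh_idealOZ.loc (coh_pushforward_unit_subscheme J).ft⟩
  have hQ := ih J₂ hlt _ hQcoh isKilledBy_cokernel_idealOZ
  exact InK.of_shortExact₁ hU shortExact_idealOZ hH hQcoh.loc hQ.finite_H0

end Literature.AlgebraicGeometry.Morphisms

end
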